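import Mathlib.Analysis.SpecialFunctions.Pow.Real
import Mathlib.Analysis.SpecialFunctions.Log.Basic
import Mathlib.Analysis.SpecialFunctions.Sqrt
import HarnessLib

/-!
# The elementary optimisation at the end of the proof of Seis 2022, Thm. 2 (`p = q = 2`, `s = ∞`)

Analysis/FluidPDE proof-support file (everything proved, real arithmetic only). The analytic part
of the proof of Seis 2022, Thm. 2 (arXiv:2003.08794, p. 8) ends with the "master inequality"

  `(a/8) log(1 + m₀/(C₄ √κ)) ≤ log(1 + 1/(2√κ)) (a/64) + C_d C₀ / D + C₀ √((N/D + 1)/2)`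

(left: Lemma 4 applied to the datum, with `‖θ₀‖₁ ≥ a`; right: the brutal bound on
`D_δ(θ(t))` at a time `t ≥ N/D` with `C₀ e^{-N} ≤ a/64`, the transport term `∫₀^∞ ‖θ‖₂ ≤ C₀/D`,
and the diffusion term `κ δ⁻¹ ∫₀ᵗ ‖∇θ‖₂ ≤ C₀ √(t/2)` at `δ = √κ`, `t ≤ N/D + 1`). Here we
perform the printed conclusion ("we may assume `D < 1` … the choice `δ = √κ` yields
`log(1/κ) ≲ 1/D + 1/√D`, thus `D ≲ log⁻¹(1/κ)`"):

* `Seis.master_le` — the master inequality implies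
  `(7a/128) log(1/κ) ≤ c₁ + c₂ max(1, 1/D)` with explicit `c₁, c₂`;
* `Seis.rate_le_of_master` — if moreover `c₁ + c₂ + 1 ≤ (7a/128) log(1/κ)` (i.e. `κ ≤ κ₀`), then
  `D ≤ (128 (c₁ + c₂)/(7a)) / log(1/κ)`.

## References

* C. Seis, Comm. Math. Phys. 2022 (arXiv:2003.08794), proof of Thm. 2, p. 8. [`Seis2022`]
-/

noncomputable section

namespace Literature.Analysis.FluidPDE

namespace Seis

/-- The constant `c₁(a, m₀, C₄) = (a/64) log(3/2) + (a/8) |log(m₀/C₄)|`. [folklore] -/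
def constOne (a m₀ C₄ : ℝ) : ℝ := a / 64 * Real.log (3 / 2) + a / 8 * |Real.log (m₀ / C₄)|

/-- The constant `c₂(C_d, C₀, N) = C_d C₀ + C₀ √((N + 1)/2)`. [folklore] -/
def constTwo (Cd C₀ N : ℝ) : ℝ := Cd * C₀ + C₀ * Real.sqrt ((N + 1) / 2)

/-- `c₁ ≥ 0`. [folklore] -/
theorem constOne_nonneg {a m₀ C₄ : ℝ} (ha : 0 ≤ a) : 0 ≤ constOne a m₀ C₄ := by
  have : 0 ≤ Real.log (3 / 2) := Real.log_nonneg (by norm_num)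
  unfold constOne; positivity

/-- `c₂ ≥ 0`. [folklore] -/
theorem constTwo_nonneg {Cd C₀ N : ℝ} (hCd : 0 ≤ Cd) (hC₀ : 0 ≤ C₀) : 0 ≤ constTwo Cd C₀ N := by
  unfold constTwo; positivity

/-- **From the master inequality to `log(1/κ) ≲ max(1, 1/D)`.** [cite: Seis2022, proof of Thm. 2 (p. 8)] -/
theorem master_le {a m₀ C₄ κ Cd C₀ N D : ℝ} (ha : 0 < a) (hm₀ : 0 < m₀) (hC₄ : 0 < C₄)
    (hκ : 0 < κ) (hκ1 : κ ≤ 1) (hCd : 0 ≤ Cd) (hC₀ : 0 ≤ C₀) (hN : 0 ≤ N) (hD : 0 < D)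
    (hM : a / 8 * Real.log (1 + m₀ / (C₄ * Real.sqrt κ)) ≤
      Real.log (1 + 1 / (2 * Real.sqrt κ)) * (a / 64) + Cd * C₀ / D + C₀ * Real.sqrt ((N / D + 1) / 2)) :
    7 * a / 128 * Real.log κ⁻¹ ≤ constOne a m₀ C₄ + constTwo Cd C₀ N * max 1 D⁻¹ := by
  set x : ℝ := Real.log κ⁻¹ with hx
  have hsκ : 0 < Real.sqrt κ := Real.sqrt_pos.2 hκ
  have hsκ1 : Real.sqrt κ ≤ 1 := by rw [← Real.sqrt_one]; exact Real.sqrt_le_sqrt hκ1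
  -- `log(1/√κ) = x/2`
  have hlog_sqrt : Real.log (Real.sqrt κ)⁻¹ = x / 2 := by
    rw [Real.log_inv, Real.log_sqrt hκ.le, hx, Real.log_inv]; ring
  -- lower bound of the left-hand side
  have hL : Real.log (m₀ / C₄) + x / 2 ≤ Real.log (1 + m₀ / (C₄ * Real.sqrt κ)) := by
    have hpos : 0 < m₀ / (C₄ * Real.sqrt κ) := by positivity
    calc Real.log (m₀ / C₄) + x / 2 = Real.log (m₀ / (C₄ * Real.sqrt κ)) := by
          rw [← hlog_sqrt, ← Real.log_mul (by positivity) (by positivity)]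
          congr 1; field_simp
      _ ≤ Real.log (1 + m₀ / (C₄ * Real.sqrt κ)) := Real.log_le_log hpos (by linarith)
  -- upper bound of the logarithm on the right
  have hR : Real.log (1 + 1 / (2 * Real.sqrt κ)) ≤ Real.log (3 / 2) + x / 2 := by
    have hpos : 0 < 1 + 1 / (2 * Real.sqrt κ) := by positivity
    calc Real.log (1 + 1 / (2 * Real.sqrt κ)) ≤ Real.log (3 / 2 * (Real.sqrt κ)⁻¹) := by
          refine Real.log_le_log hpos ?_
          rw [div_eq_mul_inv, mul_inv, ← mul_assoc]
          have : 1 ≤ (Real.sqrt κ)⁻¹ := one_le_inv_iff₀.2 ⟨hsκ, hsκ1⟩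
          nlinarith [this]
      _ = Real.log (3 / 2) + x / 2 := by
          rw [Real.log_mul (by norm_num) (by positivity), hlog_sqrt]
  -- the `D`-dependent terms
  have hT : Cd * C₀ / D + C₀ * Real.sqrt ((N / D + 1) / 2) ≤ constTwo Cd C₀ N * max 1 D⁻¹ := by
    unfold constTwo
    rcases le_or_gt 1 D with hD1 | hD1
    · -- `D ≥ 1`
      have hinv : D⁻¹ ≤ 1 := inv_le_one_of_one_le₀ hD1
      have hmax : max 1 D⁻¹ = 1 := max_eq_left hinv
      rw [hmax, mul_one]
      have h1 : Cd * C₀ / D ≤ Cd * C₀ := by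
        rw [div_eq_mul_inv]; exact mul_le_of_le_one_right (by positivity) hinv
      have h2 : Real.sqrt ((N / D + 1) / 2) ≤ Real.sqrt ((N + 1) / 2) := by
        refine Real.sqrt_le_sqrt ?_
        have : N / D ≤ N := by rw [div_eq_mul_inv]; exact mul_le_of_le_one_right hN hinv
        linarith
      nlinarith [h1, h2, mul_le_mul_of_nonneg_left h2 hC₀]
    · -- `D < 1`
      have hinv : 1 ≤ D⁻¹ := (one_le_inv_iff₀.2 ⟨hD, hD1.le⟩)
      have hmax : max 1 D⁻¹ = D⁻¹ := max_eq_right hinv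
      rw [hmax]
      have h2 : Real.sqrt ((N / D + 1) / 2) ≤ Real.sqrt ((N + 1) / 2) * D⁻¹ := by
        have hstep : (N / D + 1) / 2 ≤ (N + 1) / 2 * D⁻¹ := by
          rw [div_eq_mul_inv N D]
          nlinarith [mul_nonneg hN (sub_nonneg.2 hinv)]
        calc Real.sqrt ((N / D + 1) / 2) ≤ Real.sqrt ((N + 1) / 2 * D⁻¹) := Real.sqrt_le_sqrt hstep
          _ = Real.sqrt ((N + 1) / 2) * Real.sqrt D⁻¹ := Real.sqrt_mul (by positivity) _
          _ ≤ Real.sqrt ((N + 1) / 2) * D⁻¹ := by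
              refine mul_le_mul_of_nonneg_left ?_ (Real.sqrt_nonneg _)
              rw [Real.sqrt_le_left (by positivity)]
              nlinarith [hinv]
      calc Cd * C₀ / D + C₀ * Real.sqrt ((N / D + 1) / 2)
          ≤ Cd * C₀ * D⁻¹ + C₀ * (Real.sqrt ((N + 1) / 2) * D⁻¹) := by
            rw [div_eq_mul_inv]
            exact add_le_add le_rfl (mul_le_mul_of_nonneg_left h2 hC₀)
        _ = (Cd * C₀ + C₀ * Real.sqrt ((N + 1) / 2)) * D⁻¹ := by ring
  -- combine
  have habs : -(a / 8 * Real.log (m₀ / C₄)) ≤ a / 8 * |Real.log (m₀ / C₄)| := by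
    have := neg_abs_le (Real.log (m₀ / C₄))
    nlinarith [this]
  have hlhs := mul_le_mul_of_nonneg_left hL (by positivity : (0 : ℝ) ≤ a / 8)
  have hrhs := mul_le_mul_of_nonneg_left hR (by positivity : (0 : ℝ) ≤ a / 64)
  unfold constOne
  nlinarith [hlhs, hrhs, hT, hM, habs]

/-- **From `log(1/κ) ≲ max(1, 1/D)` to the rate bound**, for `κ` so small that the `D ≥ 1`
alternative is excluded. [cite: Seis2022, proof of Thm. 2 (p. 8)] -/
theorem rate_le_of_master {a c₁ c₂ D x : ℝ} (ha : 0 < a) (hc₁ : 0 ≤ c₁) (hc₂ : 0 ≤ c₂) (hD : 0 < D)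
    (hx : c₁ + c₂ + 1 ≤ 7 * a / 128 * x) (hM : 7 * a / 128 * x ≤ c₁ + c₂ * max 1 D⁻¹) :
    D ≤ 128 * (c₁ + c₂) / (7 * a) / x := by
  have hx0 : 0 < x := by
    by_contra hle
    have : 7 * a / 128 * x ≤ 0 := mul_nonpos_of_nonneg_of_nonpos (by positivity) (le_of_not_gt hle)
    linarith
  rcases le_or_gt 1 D with hD1 | hD1
  · exfalso
    have hmax : max 1 D⁻¹ = 1 := max_eq_left (inv_le_one_of_one_le₀ hD1)
    rw [hmax, mul_one] at hM
    linarith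
  · have hinv : 1 ≤ D⁻¹ := (one_le_inv_iff₀.2 ⟨hD, hD1.le⟩)
    have hmax : max 1 D⁻¹ = D⁻¹ := max_eq_right hinv
    rw [hmax] at hM
    have h1 : 7 * a / 128 * x ≤ (c₁ + c₂) * D⁻¹ := by
      have : c₁ ≤ c₁ * D⁻¹ := le_mul_of_one_le_right hc₁ hinv
      nlinarith [hM, this]
    have h2 : D * (7 * a / 128 * x) ≤ c₁ + c₂ := by
      have := mul_le_mul_of_nonneg_left h1 hD.le
      rwa [mul_comm D ((c₁ + c₂) * D⁻¹), mul_assoc, inv_mul_cancel₀ hD.ne', mul_one] at this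
    rw [le_div_iff₀ hx0, le_div_iff₀ (by positivity)]
    nlinarith [h2]

end Seis

end Literature.Analysis.FluidPDE
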